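import Literature.AlgebraicGeometry.Frobenioids.ArchimedeanUnitTopologyAngular
import Literature.AlgebraicGeometry.Frobenioids.ArchimedeanCharSplitting
import HarnessLib

/-!
# Frobenioids II, Remark 3.6.1 and Theorem 3.6 (i) (characteristic splitting): HEAD-EXACT closers of the
# GENERIC typed statements `ArchFrd.Rmk361`, `ArchFrd.Thm36i_charSplitting` at the archimedean / angular
# Frobenioids of Example 3.3, over EVERY base (D-0079 L-F [FrdI/II], pack A, rows F-0779 · F-0701)

Mochizuki, *The geometry of Frobenioids II: poly-Frobenioids*, Kyushu J. Math. **62** (2008) 401–460, §3,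
Remark 3.6.1, author's kurims text p. 39 [cite: MochizukiFrdII2008, Rmk 3.6.1 p.39]; Theorem 3.6 (i)
(characteristic splitting clause), p. 36 [cite: MochizukiFrdII2008, Thm 3.6 (i) p.36].

PROOF-ONLY companion (abc-iut cell, seat abc-iut-f-015 gen 6).  The generic schemata `ArchFrd.Rmk361 G F Λ V bd vMap`
(`ArchimedeanBasicProperties.lean`, abc-iut-L1-t9) and `ArchFrd.Thm36i_charSplitting F radial`
(`ArchimedeanStandardType.lean`, abc-iut-L1-t6) quantify over arbitrary pre-Frobenioid data; their printed subjects
are the Frobenioids `C`, `A` of Example 3.3 with their boundary / radial data, where the tree PROVES them for every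
base `π : D → D₀` — abc-iut-w5-d112's `ArchFrd.rmk361_C` / `ArchFrd.rmk361_A` (heads `Rmk361_C`, `Rmk361_A`) and
abc-iut-w5-d246's `ArchFrd.thm36i_charSplitting_C` (head `Thm36i_charSplitting_C`).  This file only RE-HEADS those
theorems so that their conclusion head is the generic FACT declaration itself (definitional unfolding, one line
each); no new mathematics, no definition.  Honest framing: typed ≠ proved elsewhere; nothing here bears on
[IUTchIII] Cor. 3.12; no side taken.
-/

namespace Literature.AlgebraicGeometry.Frobenioids

open CategoryTheory

noncomputable section

namespace ArchFrd

universe v u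

variable {D : Type u} [Category.{v} D] (π : D ⥤ D0)

/-- **[FrdII] Remark 3.6.1 at the archimedean Frobenioid `C` of Ex. 3.3 (ii), every base** — `O^×(A) ≅ S¹` as a
topological group through the orbit maps onto `∂A_A`, for complex isotropic `A` (`Λ = ℤ`); head = the generic
`ArchFrd.Rmk361`. FACT-LIST F-0779. [cite: MochizukiFrdII2008, Rmk 3.6.1 p.39] -/
theorem rmk361_generic_C :
    Literature.AlgebraicGeometry.Frobenioids.ArchFrd.Rmk361 (baseRC π) (C.toElem π) .Z (ambient π) (bd π) (vMap π) :=
  rmk361_C π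

/-- **[FrdII] Remark 3.6.1 at the angular Frobenioid `A` of Ex. 3.3 (iii), every base**; head = the generic
`ArchFrd.Rmk361`. FACT-LIST F-0779. [cite: MochizukiFrdII2008, Rmk 3.6.1 p.39] -/
theorem rmk361_generic_A :
    Literature.AlgebraicGeometry.Frobenioids.ArchFrd.Rmk361 (baseRC π) (A.toElem π) .Z
      (fun X => ambient π X.obj) (bdA π) (vMapA π) :=
  rmk361_A π

/-- **[FrdII] Thm. 3.6 (i), characteristic-splitting clause, at `C = C^ℤ` of Ex. 3.3 (ii), every base** — the
canonical decomposition determines a characteristic splitting whose value at each isotropic object is the monoid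
of radial elements of `O^▷`; head = the generic `ArchFrd.Thm36i_charSplitting`. FACT-LIST F-0701.
[cite: MochizukiFrdII2008, Thm 3.6 (i) p.36] -/
theorem thm36i_charSplitting_generic_C :
    Literature.AlgebraicGeometry.Frobenioids.ArchFrd.Thm36i_charSplitting (C.toElem π) (radialO π) :=
  thm36i_charSplitting_C π

end ArchFrd

end

end Literature.AlgebraicGeometry.Frobenioids
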